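import Summits.HubbardSuperconductivity.HubbardSuperconductivity.Theorems.SoloBlindDimerCondensate
import Summits.HubbardSuperconductivity.HubbardSuperconductivity.Theorems.SoloBlindMottFloor
import HarnessLib

/-!
# The `δ`-uniform crutch threshold at strong coupling (solo-blind programme, Theorem 34, part 3/3)

Theorem 33 (`SoloBlindDimerCondensate`) puts d-wave pair-field long-range order on every sector
ground state of the crutched Hubbard Hamiltonian `H_U - (g/L²) ΔᴴΔ` once `g ≥ 32/δ`, for every
`U ≥ 0`; the `1/δ` comes from comparing the pairing gain `≈ g δ n` of the Gutzwiller dimer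
condensate with the crude floor `-8n` of the doped sector (free motion of all `2n` electrons).

At strong coupling the floor is much higher: by the Mott floor (`SoloBlindMottFloor`,
`re ⟨ψ, H_U ψ⟩ ≥ -(4 (L² - N) + 64 L²/U) ‖ψ‖²` for `U ≥ 16`) only the `δ L²` holes move freely.
On the other side the dimer condensate has kinetic energy EXACTLY zero
(`star_condensate_hop_condensate`: a single hop never maps a dimer configuration to a dimer
configuration, because the partner orbital of the moved electron pins its dimer) and no double
occupancy, so `re ⟨Ψ_n, H_U Ψ_n⟩ = 0` for every `U` (`re_expect_hubbardTorus_condensate_eq_zero`).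

**Theorem 34 (`strongCoupling_crutch_hasLongRangeOrder`).** For `δ ∈ (0, 1/2)`, `U ≥ 64/δ` and
every `g ≥ 48`, EVERY normalised ground-state family of `H_U - (g/L²) ΔᴴΔ` in the doped sectors
`(2⌊(1-δ)L²/2⌋, S_z = 0)` of the even tori has d-wave pair-field long-range order (order density
`κ = δ`; even sides `L ≥ max (4, 4/δ)` feed Theorem 24(c)).  The threshold `48` depends neither on
`U` nor on `δ`: in the regime `U δ ≥ 64` the proved-order region of the `(U, g)` plane of the
obstruction report §5.20 reaches down to `g = 48`, against `32/δ → ∞` as `δ → 0` from Theorem 33.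

**Theorem 33′ (`uniform_crutch_hasLongRangeOrder'`).** The same kinetic zero, against the free
floor `-8n` valid for every `U ≥ 0`, sharpens Theorem 33's threshold from `g ≥ 32/δ` to
`g > 8/δ` (margin `3(gδ - 8)/16 · L²`).

Honest label: Theorem 34 is the first statement of the crutch analysis in which the repulsion `U`
is USED — but only as a Mott suppression of the competitors' kinetic energy (a floor effect), not
as a pairing mechanism; the attraction is still the explicit crutch, and obstruction W3 is
untouched. [this work]
-/

noncomputable section

namespace Summit.HubbardSuperconductivity.HubbardSuperconductivity.Theorems.DimerCondensate

open Matrix Finset Literature.Probability.LatticeModels Literature.MathematicalPhysics.QuantumLattice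
  Literature.MathematicalPhysics.QuantumLattice.EigenvalueContinuation
open scoped ComplexOrder ComplexConjugate

variable {L : ℕ} [NeZero L]

/-- Torus sites are compared through the linear order (pins `DecidableEq (FermionTorus 2 L)` as in
parts 1–3 of Theorem 33). [folklore] -/
local instance (priority := high) instDecidableEqFermionTorusDimer₄ : DecidableEq (FermionTorus 2 L) :=
  LinearOrder.toDecidableEq

/-- The vertical unit step `e₂ = (0, 1)` of `ℤ²` (literal term). -/
local notation "𝐞" => (Pi.single 1 1 : Site 2)

/-- The down orbital of the dimer at slot `k`. -/
local notation "D[" k "]" => (orb (FermionTorus.ofTorusSite k) 1)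

/-- The up orbital of the dimer at slot `k` (at the site `k + e₂`). -/
local notation "U[" k "]" => (orb (FermionTorus.ofTorusSite (k + Torus.proj L 𝐞)) 0)

/-- The basis vector of the dimer configuration `S`. -/
local notation "Φ[" S "]" =>
  (Pi.single (dimerConfig S) (1 : ℂ) : Fock (Orb (FermionTorus 2 L)))

/-- The `j`-dimer condensate over the slots. -/
local notation "Ψ[" j "]" => (∑ S ∈ Finset.powersetCard j (dimerSlots L), Φ[S])

/-! ### The dimer condensate has no kinetic energy -/

/-- **A single hop never connects two dimer configurations.**  If `t₁ = u ∪ (x,σ)` and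
`t₂ = u ∪ (y,σ)` (`x ≠ y`, `(x,σ) ∉ u`) were both dimer configurations, the partner orbital of
`(x,σ)` in `t₁` would lie in `u ⊆ t₂`, forcing `(x,σ) ∈ t₂`, i.e. `(x,σ) ∈ u`. [this work] -/
theorem hop_not_both_dimer {x y : FermionTorus 2 L} {σ : Fin 2} (hxy : x ≠ y)
    {u t₁ t₂ : Finset (Orb (FermionTorus 2 L))}
    (h₁ : ∀ o, o ∈ t₁ ↔ o = orb x σ ∨ o ∈ u) (h₂ : ∀ o, o ∈ t₂ ↔ o = orb y σ ∨ o ∈ u)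
    (ha : orb x σ ∉ u) {S T : Finset (TorusSite 2 L)} (hT : t₁ = dimerConfig T)
    (hS : t₂ = dimerConfig S) : False := by
  subst hT hS
  obtain ⟨kx, rfl⟩ : ∃ k, x = FermionTorus.ofTorusSite k :=
    ⟨x.toTorusSite, (FermionTorus.ofTorusSite_toTorusSite x).symm⟩
  obtain ⟨ky, rfl⟩ : ∃ k, y = FermionTorus.ofTorusSite k :=
    ⟨y.toTorusSite, (FermionTorus.ofTorusSite_toTorusSite y).symm⟩
  have hab : orb (FermionTorus.ofTorusSite kx) σ ≠ orb (FermionTorus.ofTorusSite ky) σ :=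
    fun h => hxy (orb_inj.1 h).1
  have ha1 : orb (FermionTorus.ofTorusSite kx) σ ∈ dimerConfig T := (h₁ _).2 (Or.inl rfl)
  by_cases hσ : σ = 0
  · subst hσ
    have hkT : kx - Torus.proj L 𝐞 ∈ T := (orb_zero_mem_dimerConfig T kx).1 ha1
    have hD1 : D[kx - Torus.proj L 𝐞] ∈ dimerConfig T := (dn_mem_dimerConfig T _).2 hkT
    have hDu : D[kx - Torus.proj L 𝐞] ∈ u := ((h₁ _).1 hD1).resolve_left (dn_ne_orb_zero _ _)
    have hkS : kx - Torus.proj L 𝐞 ∈ S := (dn_mem_dimerConfig S _).1 ((h₂ _).2 (Or.inr hDu))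
    have hU2 : U[kx - Torus.proj L 𝐞] ∈ dimerConfig S := (up_mem_dimerConfig S _).2 hkS
    rw [sub_add_cancel] at hU2
    rcases (h₂ _).1 hU2 with h | h
    · exact hab h
    · exact ha h
  · obtain rfl : σ = 1 := Fin.eq_one_of_ne_zero σ hσ
    have hkT : kx ∈ T := (dn_mem_dimerConfig T kx).1 ha1
    have hU1 : U[kx] ∈ dimerConfig T := (up_mem_dimerConfig T kx).2 hkT
    have hUu : U[kx] ∈ u := ((h₁ _).1 hU1).resolve_left (up_ne_dn kx kx)
    have hkS : kx ∈ S := (up_mem_dimerConfig S kx).1 ((h₂ _).2 (Or.inr hUu))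
    have hD2 : D[kx] ∈ dimerConfig S := (dn_mem_dimerConfig S kx).2 hkS
    rcases (h₂ _).1 hD2 with h | h
    · exact hab h
    · exact ha h

/-- The condensate is supported on dimer configurations. [this work] -/
theorem exists_of_condensate_apply_ne_zero {j : ℕ} {s : Finset (Orb (FermionTorus 2 L))}
    (h : (Ψ[j] : Fock (Orb (FermionTorus 2 L))) s ≠ 0) :
    ∃ S ∈ Finset.powersetCard j (dimerSlots L), s = dimerConfig S := by
  rw [Finset.sum_apply] at h
  obtain ⟨S, hS, hne⟩ := Finset.exists_ne_zero_of_sum_ne_zero h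
  refine ⟨S, hS, ?_⟩
  by_contra hs
  exact hne (by rw [Pi.single_apply, if_neg hs])

/-- **The dimer condensate has no kinetic energy**: `⟨Ψ_j, c†_{xσ} c_{yσ} Ψ_j⟩ = 0` for `x ≠ y`.
[this work] -/
theorem star_condensate_hop_condensate (j : ℕ) {x y : FermionTorus 2 L} (hxy : x ≠ y)
    (σ : Fin 2) :
    star Ψ[j] ⬝ᵥ ((creation (orb x σ) * annihilation (orb y σ)) *ᵥ Ψ[j]) = 0 := by
  have h := MottFloor.norm_hop_le (orb x σ) (orb y σ) (Ψ[j] : Fock (Orb (FermionTorus 2 L)))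
  refine norm_le_zero_iff.1 (h.trans (Finset.sum_nonpos fun u _ => ?_))
  split_ifs with hu
  · by_contra hpos
    rcases mul_ne_zero_iff.1 (fun h0 => hpos h0.le) with ⟨h1, h2⟩
    obtain ⟨T, -, hT⟩ := exists_of_condensate_apply_ne_zero (norm_ne_zero_iff.1 h1)
    obtain ⟨S, -, hS⟩ := exists_of_condensate_apply_ne_zero (norm_ne_zero_iff.1 h2)
    exact hop_not_both_dimer hxy (fun o => Finset.mem_insert) (fun o => Finset.mem_insert) hu.1
      hT hS
  · exact le_rfl

/-- **Energy of the condensate is exactly zero for every `U`**: no kinetic energy (above) and no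
double occupancy (`interaction_mulVec_condensate`). [this work] -/
theorem re_expect_hubbardTorus_condensate_eq_zero (hL : Even L) (U : ℝ) (j : ℕ) :
    (star Ψ[j] ⬝ᵥ (hubbardTorus 2 L 1 U *ᵥ Ψ[j])).re = 0 := by
  have hkin : ∀ (x y : FermionTorus 2 L) (σ : Fin 2),
      star Ψ[j] ⬝ᵥ ((if (fermionTorusGraph 2 L).Adj x y then
          creation (orb x σ) * annihilation (orb y σ) else 0) *ᵥ Ψ[j]) = 0 := by
    intro x y σ
    rw [MottFloor.dotProduct_ite_mulVec]
    split_ifs with hadj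
    · exact star_condensate_hop_condensate j hadj.ne σ
    · rfl
  simp only [hubbardTorus, hamiltonian, Complex.ofReal_one, neg_smul, one_smul, Matrix.add_mulVec,
    Matrix.neg_mulVec, Matrix.smul_mulVec, interaction_mulVec_condensate hL j, smul_zero, add_zero,
    dotProduct_neg, Matrix.sum_mulVec, dotProduct_sum, hkin, Finset.sum_const_zero, neg_zero,
    Complex.zero_re]

/-! ### Theorem 34 -/

set_option maxHeartbeats 400000 in
/-- **The dimer condensate against the Mott floor** (even side `L ≥ max (4, 4/δ)`,
`δ ∈ (0, 1/2)`, `U ≥ 64/δ`, `g ≥ 48`): with `n = ⌊(1-δ)L²/2⌋`,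
`re ⟨Ψ_n, (H_U - (g/L²) ΔᴴΔ) Ψ_n⟩ ≤ (minEnergyOn (H_U) (2n, 0) - δ L²) ‖Ψ_n‖²`. [this work] -/
theorem strongCoupling_trial (hL4 : 4 ≤ L) (hL : Even L) {δ : ℝ}
    (hδ : δ ∈ Set.Ioo (0 : ℝ) (1 / 2)) (hLδ : 4 / δ ≤ (L : ℝ)) {U : ℝ} (hU : 64 / δ ≤ U)
    {g : ℝ} (hg : 48 ≤ g) :
    ∃ Ψ : Fock (Orb (FermionTorus 2 L)),
      Ψ ∈ szSector (Λ := FermionTorus 2 L) (2 * ⌊(1 - δ) * (L : ℝ) ^ 2 / 2⌋₊) 0 ∧ Ψ ≠ 0 ∧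
      (star Ψ ⬝ᵥ (hubbardTorus 2 L 1 U + ((-(g / (L : ℝ) ^ 2) : ℝ) : ℂ) •
          ((pairField dWaveFormFactor L)ᴴ * pairField dWaveFormFactor L)) *ᵥ Ψ).re ≤
        ((hubbardTorus 2 L 1 U).minEnergyOn
            (szSector (Λ := FermionTorus 2 L) (2 * ⌊(1 - δ) * (L : ℝ) ^ 2 / 2⌋₊) 0)
          - δ * (L : ℝ) ^ 2) * (star Ψ ⬝ᵥ Ψ).re := by
  obtain ⟨hδ0, hδ1⟩ := hδ
  have hL3 : 3 ≤ L := le_trans (by norm_num) hL4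
  have hLr : (4 : ℝ) ≤ (L : ℝ) := by exact_mod_cast hL4
  have hLsq : (16 : ℝ) ≤ (L : ℝ) ^ 2 := by nlinarith
  have hδL : 4 ≤ δ * (L : ℝ) := by
    have := (div_le_iff₀ hδ0).1 hLδ; linarith
  have hδL2 : 16 ≤ δ * (L : ℝ) ^ 2 := by nlinarith
  have hU0 : 0 < U := lt_of_lt_of_le (by positivity) hU
  have hU16 : 16 ≤ U := by
    have h128 : (128 : ℝ) ≤ 64 / δ := by
      rw [le_div_iff₀ hδ0]; linarith
    linarith
  have hUδ : 64 ≤ U * δ := by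
    have := (div_le_iff₀ hδ0).1 hU; linarith
  have hg0 : 0 < g := by linarith
  have harg : 0 ≤ (1 - δ) * (L : ℝ) ^ 2 / 2 := by nlinarith
  -- `n = ⌊(1-δ)L²/2⌋ = j + 1`
  have hn1 : 1 ≤ ⌊(1 - δ) * (L : ℝ) ^ 2 / 2⌋₊ := by
    rw [Nat.one_le_floor_iff]
    nlinarith
  obtain ⟨j, hj⟩ : ∃ j, ⌊(1 - δ) * (L : ℝ) ^ 2 / 2⌋₊ = j + 1 :=
    ⟨_, (Nat.sub_add_cancel hn1).symm⟩
  have hn_le : ((j + 1 : ℕ) : ℝ) ≤ (1 - δ) * (L : ℝ) ^ 2 / 2 := by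
    rw [← hj]; exact Nat.floor_le harg
  have hn_ge : (1 - δ) * (L : ℝ) ^ 2 / 2 - 1 ≤ ((j + 1 : ℕ) : ℝ) := by
    rw [← hj]; linarith [Nat.lt_floor_add_one ((1 - δ) * (L : ℝ) ^ 2 / 2)]
  rw [hj]
  -- `m = #slots = L²/2`
  set m := (dimerSlots L).card with hm
  have h2m : 2 * (m : ℝ) = (L : ℝ) ^ 2 := by exact_mod_cast two_mul_card_dimerSlots hL
  have hjm : ((j + 1 : ℕ) : ℝ) ≤ (m : ℝ) := by nlinarith
  have hjm' : j + 1 ≤ m := by exact_mod_cast hjm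
  have hmj : ((m - j : ℕ) : ℝ) = (m : ℝ) - j := by
    rw [Nat.cast_sub (by omega)]
  have hne : (Ψ[j + 1] : Fock (Orb (FermionTorus 2 L))) ≠ 0 := condensate_ne_zero hjm'
  have hK : szSector (Λ := FermionTorus 2 L) (2 * (j + 1)) 0 ≠ ⊥ :=
    (Submodule.ne_bot_iff _).2 ⟨_, condensate_mem_szSector (j + 1), hne⟩
  refine ⟨Ψ[j + 1], condensate_mem_szSector (j + 1), hne, ?_⟩
  rw [re_rayleigh_add_real_smul]
  set P := (star Ψ[j + 1] ⬝ᵥ Ψ[j + 1]).re with hP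
  have hP0 : 0 ≤ P := (re_star_dotProduct_self_pos hne).le
  have hO := condensate_order_ge hL3 hL j
  have hH := re_expect_hubbardTorus_condensate_eq_zero hL U (j + 1)
  have hmin := MottFloor.mott_floor_minEnergyOn (L := L) hU16 (N := 2 * (j + 1)) (M := 0) hK
  rw [hmj] at hO
  -- abbreviations
  set n' : ℝ := ((j + 1 : ℕ) : ℝ) with hn'
  set E := (hubbardTorus 2 L 1 U).minEnergyOn (szSector (Λ := FermionTorus 2 L) (2 * (j + 1)) 0)
    with hE
  set RO := (star Ψ[j + 1] ⬝ᵥ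
    ((pairField dWaveFormFactor L)ᴴ * pairField dWaveFormFactor L) *ᵥ Ψ[j + 1]).re with hRO
  set RH := (star Ψ[j + 1] ⬝ᵥ hubbardTorus 2 L 1 U *ᵥ Ψ[j + 1]).re with hRH
  have hN : (((2 * (j + 1) : ℕ)) : ℝ) = 2 * n' := by rw [hn']; push_cast; ring
  rw [hN] at hmin
  have hjr : (j : ℝ) = n' - 1 := by
    rw [hn']; push_cast; ring
  -- `m - j ≥ δ L² / 2`, `n' ≥ 3 L² / 16`
  have hmj_ge : δ * (L : ℝ) ^ 2 / 2 ≤ (m : ℝ) - j := by rw [hjr]; linarith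
  have hn'_ge : 3 * (L : ℝ) ^ 2 / 16 ≤ n' := by nlinarith
  -- the Mott floor terms: `4 (L² - 2n') ≤ 4 δ L² + 8`, `64 L²/U ≤ δ L²`
  have hholes : 4 * ((L : ℝ) ^ 2 - 2 * n') ≤ 4 * δ * (L : ℝ) ^ 2 + 8 := by nlinarith
  have h64 : 64 * (L : ℝ) ^ 2 / U ≤ δ * (L : ℝ) ^ 2 := by
    rw [div_le_iff₀ hU0]; nlinarith
  -- the pairing gain: `(g/L²) · 2 n' (m - j) ≥ g δ n' ≥ 9 δ L²`
  have e1 : g / (L : ℝ) ^ 2 * (2 * n' * (δ * (L : ℝ) ^ 2 / 2)) = g * δ * n' := by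
    field_simp
  have e2 : g / (L : ℝ) ^ 2 * (2 * n' * (δ * (L : ℝ) ^ 2 / 2)) ≤
      g / (L : ℝ) ^ 2 * (2 * n' * ((m : ℝ) - j)) :=
    mul_le_mul_of_nonneg_left (mul_le_mul_of_nonneg_left hmj_ge (by positivity)) (by positivity)
  have q1 : 48 * (δ * n') ≤ g * (δ * n') := mul_le_mul_of_nonneg_right hg (by positivity)
  have q2 : δ * (3 * (L : ℝ) ^ 2 / 16) ≤ δ * n' := mul_le_mul_of_nonneg_left hn'_ge hδ0.le
  have key : 4 * ((L : ℝ) ^ 2 - 2 * n') + 64 * (L : ℝ) ^ 2 / U + δ * (L : ℝ) ^ 2 ≤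
      g / (L : ℝ) ^ 2 * (2 * n' * ((m : ℝ) - j)) := by
    linarith [e1, e2, q1, q2, hholes, h64, hδL2]
  -- assemble
  have stepa : -(g / (L : ℝ) ^ 2) * RO ≤ -(g / (L : ℝ) ^ 2) * (2 * n' * ((m : ℝ) - j) * P) :=
    mul_le_mul_of_nonpos_left hO (by rw [neg_nonpos]; positivity)
  have stepb : (-(g / (L : ℝ) ^ 2 * (2 * n' * ((m : ℝ) - j)))) * P ≤
      (E - δ * (L : ℝ) ^ 2) * P :=
    mul_le_mul_of_nonneg_right (by linarith) hP0
  linarith [hH, stepa, stepb]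

/-- **Theorem 34 (the `δ`-uniform crutch threshold at strong coupling).** For `δ ∈ (0, 1/2)`,
`U ≥ 64/δ` and every `g ≥ 48`, EVERY normalised ground-state family of the crutched Hubbard
Hamiltonians `H_U - (g/L²) Δ_dᴴ Δ_d` in the doped sectors `(2⌊(1-δ)L²/2⌋, S_z = 0)` of the even tori
has d-wave pair-field long-range order.  The threshold depends neither on `U` nor on `δ`
(Theorem 33: `g ≥ 32/δ` for all `U ≥ 0`). [this work] -/
theorem strongCoupling_crutch_hasLongRangeOrder {δ : ℝ} (hδ : δ ∈ Set.Ioo (0 : ℝ) (1 / 2))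
    {U : ℝ} (hU : 64 / δ ≤ U) {g : ℝ} (hg : 48 ≤ g)
    (ψ : ∀ L, Fock (Orb (FermionTorus 2 L)))
    (hψ : ∀ m : ℕ, Even (m + 1) → star (ψ (m + 1)) ⬝ᵥ ψ (m + 1) = 1 ∧
      IsGroundStateInSector
        (hubbardTorus 2 (m + 1) 1 U + ((-(g / ((m + 1 : ℕ) : ℝ) ^ 2) : ℝ) : ℂ) •
          ((pairField dWaveFormFactor (m + 1))ᴴ * pairField dWaveFormFactor (m + 1)))
        (2 * ⌊(1 - δ) * ((m + 1 : ℕ) : ℝ) ^ 2 / 2⌋₊) 0 (ψ (m + 1))) :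
    HasLongRangeOrder (fun k => halfOpenBox 2 (2 * k))
      (fun k => torusPullback (pairFieldCorr dWaveFormFactor ψ) (2 * k)) := by
  have hδ0 : 0 < δ := hδ.1
  have hg0 : 0 < g := by linarith
  refine CrutchAxis.crutch_hasLongRangeOrder_of_trials U hg0 hδ0 (L₁ := max 4 ⌈4 / δ⌉₊)
    (fun m hm hL₁ => strongCoupling_trial (L := m + 1) (le_trans (le_max_left _ _) hL₁) hm hδ
      ?_ hU hg) ψ hψ
  have h : (⌈4 / δ⌉₊ : ℝ) ≤ ((m + 1 : ℕ) : ℝ) := by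
    exact_mod_cast le_trans (le_max_right 4 _) hL₁
  exact le_trans (Nat.le_ceil _) h

/-! ### Theorem 33′: the `U`-uniform threshold sharpened by the exact kinetic zero -/

/-- **The dimer condensate with its exact kinetic zero against the free floor** (even side
`L ≥ 4`, `U ≥ 0`, `δ ∈ (0, 1/2)`, `g > 8/δ`): with `n = ⌊(1-δ)L²/2⌋`,
`re ⟨Ψ_n, (H_U - (g/L²) ΔᴴΔ) Ψ_n⟩ ≤ (minEnergyOn (H_U) (2n, 0) - (3(gδ-8)/16) L²) ‖Ψ_n‖²`.
[this work] -/
theorem zeroKinetic_trial (hL4 : 4 ≤ L) (hL : Even L) {U : ℝ} (hU : 0 ≤ U) {δ : ℝ}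
    (hδ : δ ∈ Set.Ioo (0 : ℝ) (1 / 2)) {g : ℝ} (hg : 8 / δ < g) :
    ∃ Ψ : Fock (Orb (FermionTorus 2 L)),
      Ψ ∈ szSector (Λ := FermionTorus 2 L) (2 * ⌊(1 - δ) * (L : ℝ) ^ 2 / 2⌋₊) 0 ∧ Ψ ≠ 0 ∧
      (star Ψ ⬝ᵥ (hubbardTorus 2 L 1 U + ((-(g / (L : ℝ) ^ 2) : ℝ) : ℂ) •
          ((pairField dWaveFormFactor L)ᴴ * pairField dWaveFormFactor L)) *ᵥ Ψ).re ≤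
        ((hubbardTorus 2 L 1 U).minEnergyOn
            (szSector (Λ := FermionTorus 2 L) (2 * ⌊(1 - δ) * (L : ℝ) ^ 2 / 2⌋₊) 0)
          - 3 * (g * δ - 8) / 16 * (L : ℝ) ^ 2) * (star Ψ ⬝ᵥ Ψ).re := by
  obtain ⟨hδ0, hδ1⟩ := hδ
  have hL3 : 3 ≤ L := le_trans (by norm_num) hL4
  have hLr : (4 : ℝ) ≤ (L : ℝ) := by exact_mod_cast hL4
  have hLsq : (16 : ℝ) ≤ (L : ℝ) ^ 2 := by nlinarith
  have hgδ : 8 < g * δ := by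
    have := (div_lt_iff₀ hδ0).1 hg; linarith
  have hg0 : 0 < g := lt_trans (by positivity) hg
  have harg : 0 ≤ (1 - δ) * (L : ℝ) ^ 2 / 2 := by nlinarith
  -- `n = ⌊(1-δ)L²/2⌋ = j + 1`
  have hn1 : 1 ≤ ⌊(1 - δ) * (L : ℝ) ^ 2 / 2⌋₊ := by
    rw [Nat.one_le_floor_iff]
    nlinarith
  obtain ⟨j, hj⟩ : ∃ j, ⌊(1 - δ) * (L : ℝ) ^ 2 / 2⌋₊ = j + 1 :=
    ⟨_, (Nat.sub_add_cancel hn1).symm⟩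
  have hn_le : ((j + 1 : ℕ) : ℝ) ≤ (1 - δ) * (L : ℝ) ^ 2 / 2 := by
    rw [← hj]; exact Nat.floor_le harg
  have hn_ge : (1 - δ) * (L : ℝ) ^ 2 / 2 - 1 ≤ ((j + 1 : ℕ) : ℝ) := by
    rw [← hj]; linarith [Nat.lt_floor_add_one ((1 - δ) * (L : ℝ) ^ 2 / 2)]
  rw [hj]
  -- `m = #slots = L²/2`
  set m := (dimerSlots L).card with hm
  have h2m : 2 * (m : ℝ) = (L : ℝ) ^ 2 := by exact_mod_cast two_mul_card_dimerSlots hL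
  have hjm : ((j + 1 : ℕ) : ℝ) ≤ (m : ℝ) := by nlinarith
  have hjm' : j + 1 ≤ m := by exact_mod_cast hjm
  have hmj : ((m - j : ℕ) : ℝ) = (m : ℝ) - j := by
    rw [Nat.cast_sub (by omega)]
  have hne : (Ψ[j + 1] : Fock (Orb (FermionTorus 2 L))) ≠ 0 := condensate_ne_zero hjm'
  have hK : szSector (Λ := FermionTorus 2 L) (2 * (j + 1)) 0 ≠ ⊥ :=
    (Submodule.ne_bot_iff _).2 ⟨_, condensate_mem_szSector (j + 1), hne⟩
  refine ⟨Ψ[j + 1], condensate_mem_szSector (j + 1), hne, ?_⟩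
  rw [re_rayleigh_add_real_smul]
  set P := (star Ψ[j + 1] ⬝ᵥ Ψ[j + 1]).re with hP
  have hP0 : 0 ≤ P := (re_star_dotProduct_self_pos hne).le
  have hO := condensate_order_ge hL3 hL j
  have hH := re_expect_hubbardTorus_condensate_eq_zero hL U (j + 1)
  have hmin := neg_le_minEnergyOn hL3 hU hK
  rw [hmj] at hO
  -- abbreviations
  set n' : ℝ := ((j + 1 : ℕ) : ℝ) with hn'
  set E := (hubbardTorus 2 L 1 U).minEnergyOn (szSector (Λ := FermionTorus 2 L) (2 * (j + 1)) 0)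
    with hE
  set RO := (star Ψ[j + 1] ⬝ᵥ
    ((pairField dWaveFormFactor L)ᴴ * pairField dWaveFormFactor L) *ᵥ Ψ[j + 1]).re with hRO
  set RH := (star Ψ[j + 1] ⬝ᵥ hubbardTorus 2 L 1 U *ᵥ Ψ[j + 1]).re with hRH
  have hjr : (j : ℝ) = n' - 1 := by
    rw [hn']; push_cast; ring
  -- `m - j ≥ δ L² / 2`, `n' ≥ 3 L² / 16`
  have hmj_ge : δ * (L : ℝ) ^ 2 / 2 ≤ (m : ℝ) - j := by rw [hjr]; linarith
  have hn'_ge : 3 * (L : ℝ) ^ 2 / 16 ≤ n' := by nlinarith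
  -- the pairing gain `(g/L²) · 2 n' (m - j) ≥ g δ n'` against `8 n'`
  have e1 : g / (L : ℝ) ^ 2 * (2 * n' * (δ * (L : ℝ) ^ 2 / 2)) = g * δ * n' := by
    field_simp
  have e2 : g / (L : ℝ) ^ 2 * (2 * n' * (δ * (L : ℝ) ^ 2 / 2)) ≤
      g / (L : ℝ) ^ 2 * (2 * n' * ((m : ℝ) - j)) :=
    mul_le_mul_of_nonneg_left (mul_le_mul_of_nonneg_left hmj_ge (by positivity)) (by positivity)
  have q : 0 ≤ (g * δ - 8) * (n' - 3 * (L : ℝ) ^ 2 / 16) := mul_nonneg (by linarith) (by linarith)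
  have q' : (g * δ - 8) * (n' - 3 * (L : ℝ) ^ 2 / 16) =
      g * δ * n' - 8 * n' - 3 * (g * δ - 8) / 16 * (L : ℝ) ^ 2 := by ring
  have key : 8 * n' + 3 * (g * δ - 8) / 16 * (L : ℝ) ^ 2 ≤
      g / (L : ℝ) ^ 2 * (2 * n' * ((m : ℝ) - j)) := by
    linarith [e1, e2, q, q']
  -- assemble
  have stepa : -(g / (L : ℝ) ^ 2) * RO ≤ -(g / (L : ℝ) ^ 2) * (2 * n' * ((m : ℝ) - j) * P) :=
    mul_le_mul_of_nonpos_left hO (by rw [neg_nonpos]; positivity)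
  have stepb : (-(g / (L : ℝ) ^ 2 * (2 * n' * ((m : ℝ) - j)))) * P ≤
      (E - 3 * (g * δ - 8) / 16 * (L : ℝ) ^ 2) * P :=
    mul_le_mul_of_nonneg_right (by linarith) hP0
  linarith [hH, stepa, stepb]

/-- **Theorem 33′ (the `U`-uniform crutch threshold, sharpened).** For every `U ≥ 0`,
`δ ∈ (0, 1/2)` and every `g > 8/δ`, EVERY normalised ground-state family of the crutched Hubbard
Hamiltonians `H_U - (g/L²) Δ_dᴴ Δ_d` in the doped sectors `(2⌊(1-δ)L²/2⌋, S_z = 0)` of the even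
tori has d-wave pair-field long-range order — Theorem 33 (`g ≥ 32/δ`) with the crude kinetic
bound `8` per electron replaced by the exact kinetic zero of the dimer condensate; the remaining
`8/δ` is the free floor `-8n` of the competitors. [this work] -/
theorem uniform_crutch_hasLongRangeOrder' {U : ℝ} (hU : 0 ≤ U) {δ : ℝ}
    (hδ : δ ∈ Set.Ioo (0 : ℝ) (1 / 2)) {g : ℝ} (hg : 8 / δ < g)
    (ψ : ∀ L, Fock (Orb (FermionTorus 2 L)))
    (hψ : ∀ m : ℕ, Even (m + 1) → star (ψ (m + 1)) ⬝ᵥ ψ (m + 1) = 1 ∧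
      IsGroundStateInSector
        (hubbardTorus 2 (m + 1) 1 U + ((-(g / ((m + 1 : ℕ) : ℝ) ^ 2) : ℝ) : ℂ) •
          ((pairField dWaveFormFactor (m + 1))ᴴ * pairField dWaveFormFactor (m + 1)))
        (2 * ⌊(1 - δ) * ((m + 1 : ℕ) : ℝ) ^ 2 / 2⌋₊) 0 (ψ (m + 1))) :
    HasLongRangeOrder (fun k => halfOpenBox 2 (2 * k))
      (fun k => torusPullback (pairFieldCorr dWaveFormFactor ψ) (2 * k)) := by
  have hδ0 : 0 < δ := hδ.1
  have hg0 : 0 < g := lt_trans (by positivity) hg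
  have hgδ : 8 < g * δ := by
    have := (div_lt_iff₀ hδ0).1 hg; linarith
  have hκ : 0 < 3 * (g * δ - 8) / 16 := by linarith
  exact CrutchAxis.crutch_hasLongRangeOrder_of_trials U hg0 hκ (L₁ := 4)
    (fun m hm h4 => zeroKinetic_trial (L := m + 1) h4 hm hU hδ hg) ψ hψ

end Summit.HubbardSuperconductivity.HubbardSuperconductivity.Theorems.DimerCondensate
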